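import Summits.QuantumFields.YangMills.Theses.OnsetCalibration

/-!
# Crux K2 `SubOnsetCeilings` (stmt-QuantumFields-23313) — logical geography (lead, proved; NOT a line)

`subOnsetCeilings_of_momentBounds6_dominated`: if for every datum and live floor level there is SOME unit map `a`
with the plane-resolved collar output `MomentBounds6 G r a` (e.g. the spine's E0′ ceilings at Bałaban's unit,
route `BalabanLadder` / `InfiniteVolumeContinuum`) that is DOMINATED by the both-floor onset (`a β ≤ κ·s` for every
sub-onset resolution `s`, `β` large), then `SubOnsetCeilings` holds (`ℓ₄' = ℓ₄/κ`, since `R·a(β) ≤ κ·R·s ≤ ℓ₄`).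
The domination hypothesis is an INFRARED statement (no both-floor resolution parametrically finer than the unit)
and is not claimed; this file only kernel-checks the relation between K2 and the spine's ceilings.  No summit.
-/

set_option autoImplicit false

noncomputable section

open scoped SchwartzMap
open MeasureTheory Filter Topology
open Literature.MathematicalPhysics.QuantumFieldTheory Literature.MathematicalPhysics.QuantumLattice
open Literature.MathematicalPhysics.AQFT Literature.Probability.LatticeModels
open Summit.QuantumFields.YangMills.Cruxes.OSLegsFromFemtoAndGap.DlrCollarTransfer

namespace Summit.QuantumFields.YangMills.Cruxes.SubOnsetCeilings.Geography

/-- **Logical geography (proved, NOT part of the line): ceilings at a dominated unit map give the crux.**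
If for every datum and live level there is SOME unit map `a` with the plane-resolved collar output
`MomentBounds6 G r a` (e.g. the spine's E0′ ceilings at Bałaban's unit) that is DOMINATED by the both-floor onset
(`a β ≤ κ·s` for every sub-onset resolution `s`, `β` large), then `SubOnsetCeilings` holds with `ℓ₄' = ℓ₄/κ`:
`R·a(β) ≤ κ·R·s ≤ ℓ₄`.  Recorded so that the relation to route `BalabanLadder`/`InfiniteVolumeContinuum` is
kernel-checked; the domination hypothesis is an infrared statement and is NOT claimed. -/
theorem subOnsetCeilings_of_momentBounds6_dominated
    (hdom : ∀ (G : Type) [Group G] [TopologicalSpace G] [IsTopologicalGroup G] [CompactSpace G],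
      IsCompactSimpleLieGroup G → Nonempty (G ≃ₜ* Matrix.specialUnitaryGroup (Fin 2) ℂ) →
      letI : MeasurableSpace G := borel G
      haveI : BorelSpace G := ⟨rfl⟩
      ∀ (r : LatticeRep G) (v f g h : 𝓢(EuclideanSpace ℝ (Fin 4), ℝ)) (Λ₅ : ℝ),
        ∃ ε₀ : ℝ, 0 < ε₀ ∧ ∀ ε : ℝ, 0 < ε → ε ≤ ε₀ →
          (∃ β₅ : ℝ, ∀ β : ℝ, β₅ ≤ β → ∃ s : ℝ, 0 < s ∧ s ≤ 1 ∧
            (∀ L : ℕ, Λ₅ ≤ s * L → ε ≤ Q2 G r β L s (thetaTest 4 v) v) ∧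
            (∀ L : ℕ, Λ₅ ≤ s * L → ε ≤ |Q3 G r β L s f g h|)) →
          ∃ (a : ℝ → ℝ) (κ β₆ : ℝ), 0 < κ ∧ MomentBounds6 G r a ∧
            ∀ β : ℝ, β₆ ≤ β → ∀ s : ℝ, 0 < s → s ≤ 1 →
              (∀ s' : ℝ, 2 * s ≤ s' → s' ≤ 1 →
                ¬ ((∀ L : ℕ, Λ₅ ≤ s' * L → ε ≤ Q2 G r β L s' (thetaTest 4 v) v) ∧
                   (∀ L : ℕ, Λ₅ ≤ s' * L → ε ≤ |Q3 G r β L s' f g h|))) → a β ≤ κ * s) :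
    Summit.QuantumFields.YangMills.Theses.OnsetCalibration.SubOnsetCeilings := by
  unfold Summit.QuantumFields.YangMills.Theses.OnsetCalibration.SubOnsetCeilings
  intro G _ _ _ _ hG hcl
  letI : MeasurableSpace G := borel G
  haveI : BorelSpace G := ⟨rfl⟩
  intro r v f g h Λ₅
  obtain ⟨ε₀, hε₀, h'⟩ := hdom G hG hcl r v f g h Λ₅
  refine ⟨ε₀, hε₀, fun ε hε hεle hlive => ?_⟩
  obtain ⟨a, κ, β₆, hκ, ⟨C, β₄, ℓ₄, hℓ₄, hC, hMB⟩, hle⟩ := h' ε hε hεle hlive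
  refine ⟨C, ℓ₄ / κ, max β₄ β₆, by positivity, hC, ?_⟩
  intro β hβ s hs0 hs1 hsub L n q x R hq hR hRs hRL hsep
  have haβ : a β ≤ κ * s := hle β (le_of_max_le_right hβ) s hs0 hs1 hsub
  have hRa : (R : ℝ) * a β ≤ ℓ₄ :=
    calc (R : ℝ) * a β ≤ (R : ℝ) * (κ * s) := mul_le_mul_of_nonneg_left haβ (Nat.cast_nonneg _)
      _ = κ * ((R : ℝ) * s) := by ring
      _ ≤ κ * (ℓ₄ / κ) := by gcongr
      _ = ℓ₄ := by field_simp
  exact hMB β (le_of_max_le_left hβ) L n q x R hq hR hRa hRL hsep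

end Summit.QuantumFields.YangMills.Cruxes.SubOnsetCeilings.Geography

end
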